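import Literature.NumberTheory.ComplexMultiplication.SerreLefschetzIntersectWeilTorus
import Literature.RingTheory.GaloisAlgebras.CharacterModuleTorusExactness
import HarnessLib

/-!
# Milne 1999 §6 THEOREM 6.1 IN THE LIMIT, ON `R`-POINTS: `P(R) ≅ L(R) ×_{T(R)} S(R)` for every commutative `ℚ`-algebra `R` — «identifies P with L ∩ S
# (intersection in T)», read on the functor of points of the pro-tori with the character modules `X^*(T)`, `X^*(L)`, `X^*(S)`, `X^*(P)` of g21-#1
# (J. S. Milne, *Lefschetz motives and the Tate conjecture*, Compositio Math. 117 (1999), §6 p. 66)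

Family `hodge`, lane `lit-hodgefound` (Layer A3; seat `lit-hodgefound-p27`, generation 21, row g21-#3); topic `NumberTheory/ComplexMultiplication`.
Companion of g21-#1 `SerreLefschetzSquareLimit` (§7: `T(R) = tTorusPoints R`, `L(R) = lTorusPoints p R`, `S(R) = serreLimitPoints R` (g13-#4),
`P(R) = weilTorusPoints p R` (g15-#3); `gammaTPoints`, `alphaPrimeTPoints`, `betaLPoints`, `alphaLimPoints` (g20-#3); LEMMA 6.2 on points
`gammaTPoints_alphaLimPoints`) and of g21-#2 `SerreLefschetzIntersectWeilTorus` (THEOREM 6.1 on characters: the square `X^*(T) → X^*(S)` over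
`X^*(L) → X^*(P)` is almost cartesian — `exists_lift`, `kerMap_surjective_charSquare`).  THIS FILE reads THEOREM 6.1 on `R`-points through Q768's point functor
`D(X)(R) = Hom_Γ(X, (ℚ^{cm} ⊗ R)ˣ)` (left exact, g11-#5): the homomorphism `(β(R), α(R)) : P(R) → L(R) × S(R)` is a bijection onto the fibre product
`L(R) ×_{T(R)} S(R) = {(l, s) | α′(R)(l) = γ(R)(s)}`.  Everything is PROVED (0 `sorry`, 0 new axioms; kind definition; no named fact, net debt 0, D-0026).

* `betaLPoints_injective` («β … injective because it corresponds to a surjective map on the character groups»; g11-#5 `torusPoints.comap_injective_of_surjective`).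
* `betaSec` (a set-theoretic section of `X^*(β)`), **`apply_eq_of_betaL_eq`** (KEY: for a compatible pair `(l, s)`, `l(y)` depends only on `β(y)` — LEMMA 6.3 (b)
  in the limit, g21-#2 `kerMap_surjective_charSquare`), `liftFun` (`w ↦ l(sec w)`; `_mul`, `_one`, `_smul`), **`liftPoint p 𝔴 R l s h ∈ P(R)`**,
  `liftPoint_apply_ofAdd`, **`betaLPoints_liftPoint : β(R)(f) = l`**, **`alphaLimPoints_liftPoint : α(R)(f) = s`** (by THE LIFT of g21-#2 `exists_lift`).
* **`existsUnique_weilTorusPoints`**: every compatible pair `(l, s)` is `(β(R) f, α(R) f)` for a UNIQUE `f ∈ P(R)`; **`fibreProdPoints p 𝔴 R = L(R) ×_{T(R)} S(R)`**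
  (`MonoidHom.eqLocus`; `mem_fibreProdPoints_iff`), **`toFibreProdPoints`** (`coe_toFibreProdPoints`), **`toFibreProdPoints_bijective`**,
  **`weilTorusPointsEquivFibreProd : weilTorusPoints p R ≃* fibreProdPoints p 𝔴 R`** (`coe_weilTorusPointsEquivFibreProd`), `exists_of_eq_of_eq`
  («intersection in T», on points).

SCOPE (docstring, not claims).  (1) As in g21-#1/#2 the groups enter only through character modules and `R`-points of Q768's point functor; the Tannakian
identifications (Thm 2.6, 4.3, 5.4) and Theorem 6.1 as a statement about fundamental groups of categories of motives are NOT claimed.  (2) `α′(R)` and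
`γ(R)` need not be injective on `R`-points (left exactness only), so “`L ∩ S` inside `T`” is read as the fibre product of `α′(R)` and `γ(R)` (which IS the intersection of the images when both are injective).
(3) Implementation: the four character maps of g21-#1 / g20-#3 are `seal`ed in this file after `betaLPoints_injective` (they are used only through their
proved API; folding keeps unification cheap).  (4) Nothing in this file is a case of the Hodge conjecture.

## References

* [Milne1999] J. S. Milne, *Lefschetz motives and the Tate conjecture*, Compositio Math. 117 (1999) 45–76 — §6 p. 66 L5–L6 (THEOREM 6.1 «The diagram at
  left commutes, and identifies P with L ∩ S (intersection in T)»; p. 65 L42–L44 «We have defined injective homomorphisms as in the left-hand square»),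
  L33–L49, L50 ff.
  («almost cartesian»); p. 67 L5–L9 (Lemma 6.3 (b)); §4 p. 62 L20–L23 (`β` injective) (held `paper:doi-10-1023-a-1000776613765` p0021–p0023).
* [Milne2017] J. S. Milne, *Algebraic Groups*, CUP 2017 — Ch. 12 Th. 12.9 (b), Th. 12.23, Rem. 12.26 (points of groups of multiplicative type; left
  exactness on points, g11-#5 `CharacterModuleTorusExactness`).

Provenance: lane `lit-hodgefound`, seat `lit-hodgefound-p27` gen 21 (agent `literature-prover-lit-hodgefound-p27-g21-0`), row g21-#3 (lane INBOX claim
2026-08-25, l.11212).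
-/

set_option autoImplicit false

noncomputable section

open scoped NumberField DirectSum Pointwise IntermediateField TensorProduct

namespace Literature.NumberTheory.ComplexMultiplication

namespace CMNumbers

open _root_.NumberField
open Literature.NumberTheory.NumberFields (cmNumbers cmNumbersConj cmNumbersConj_mul_self cmNumbersConj_mul_comm)
open Literature.RingTheory.GaloisAlgebras.CharacterModuleTorus (torusPoints galUnits)
open PairProduct (DAmalg dinj dliftOf)
open AlmostCartesian (IsAlmostCartesian)

section Points

universe u

variable (p : ℕ) [hp : Fact p.Prime] (𝔴 : Ideal (𝓞 cmNumbers)) [h𝔴P : 𝔴.IsPrime] [h𝔴 : 𝔴.LiesOver (Ideal.span {(p : ℤ)})]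
variable [DecidableEq CMTypeOrbits] [DecidableEq (MulAction.orbitRel.Quotient (cmNumbers ≃ₐ[ℚ] cmNumbers) (WeilLimit p))]
variable (R : Type u) [CommRing R] [Algebra ℚ R]

omit h𝔴P h𝔴 [DecidableEq CMTypeOrbits] in
/-- **`β(R) : P(R) → L(R)` IS INJECTIVE** («β : (P, p) → (L, l) … injective because it corresponds to a surjective map on the character groups», g21-#1
`betaL_surjective`, g11-#5 `torusPoints.comap_injective_of_surjective`). [cite: Milne1999, §4 p. 62 L20–L23] [cite: Milne2017, Ch. 12 Th. 12.9 (b)] -/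
theorem betaLPoints_injective : Function.Injective (betaLPoints p R) :=
  Literature.RingTheory.GaloisAlgebras.CharacterModuleTorus.torusPoints.comap_injective_of_surjective ℚ cmNumbers R (lRepL p) (weilLimRep p)
    (betaL p) (betaL_rep (p := p)) (betaL_surjective p)

-- The four character maps of g21-#1 / g20-#3 are only used through their proved API below; keeping them folded keeps unification cheap.
seal alphaPrimeT
seal gammaT
seal betaL
seal alphaLim

/-- A chosen set-theoretic section `sec` of `X^*(β) : X^*(L) → X^*(P)` (onto, g21-#1 `betaL_surjective`). [cite: Milne1999, §4 p. 62 L20–L23] -/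
def betaSec (w : Additive (WeilLimit p)) : LChar p := (betaL_surjective p w).choose

omit h𝔴P h𝔴 [DecidableEq CMTypeOrbits] in
/-- `β(sec w) = w`. [cite: Milne1999, §4 p. 62 L20–L23] -/
@[simp] theorem betaL_betaSec (w : Additive (WeilLimit p)) : betaL p (betaSec p w) = w := (betaL_surjective p w).choose_spec

variable {R}

/-- **KEY: a compatible pair `(l, s) ∈ L(R) ×_{T(R)} S(R)` reads `X^*(L)` through `X^*(P)`** — if `α′(R)(l) = γ(R)(s)` then `l(y)` depends only on `β(y)`:
`β(y) = β(y′)` gives `y − y′ ∈ Ker X^*(β) = X^*(α′)(Ker X^*(γ))` (LEMMA 6.3 (b) in the limit, g21-#2 `kerMap_surjective_charSquare`), and `l` is `1` there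
because `l ∘ X^*(α′) = s ∘ X^*(γ)`. [cite: Milne1999, §6 p. 66 L5–L6 (Theorem 6.1), p. 67 L5–L9 (Lemma 6.3 (b))] -/
theorem apply_eq_of_betaL_eq (l : lTorusPoints p R) (s : serreLimitPoints R) (h : alphaPrimeTPoints p 𝔴 R l = gammaTPoints R s)
    {y y' : LChar p} (e : betaL p y = betaL p y') :
    (l : Multiplicative (LChar p) →* (cmNumbers ⊗[ℚ] R)ˣ) (Multiplicative.ofAdd y) =
      (l : Multiplicative (LChar p) →* (cmNumbers ⊗[ℚ] R)ˣ) (Multiplicative.ofAdd y') := by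
  have hk : y - y' ∈ LinearMap.ker (betaL p) := by rw [LinearMap.mem_ker, map_sub, e, sub_self]
  obtain ⟨⟨x, hx⟩, hx'⟩ := kerMap_surjective_charSquare p 𝔴 ⟨y - y', hk⟩
  have hx'' : alphaPrimeT p 𝔴 x = y - y' := congrArg Subtype.val hx'
  have hy : y = y' + alphaPrimeT p 𝔴 x := by rw [hx'', add_sub_cancel]
  have h1 : (l : Multiplicative (LChar p) →* (cmNumbers ⊗[ℚ] R)ˣ) (Multiplicative.ofAdd (alphaPrimeT p 𝔴 x)) = 1 :=
    calc (l : Multiplicative (LChar p) →* (cmNumbers ⊗[ℚ] R)ˣ) (Multiplicative.ofAdd (alphaPrimeT p 𝔴 x))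
        = (alphaPrimeTPoints p 𝔴 R l : Multiplicative TChar →* (cmNumbers ⊗[ℚ] R)ˣ) (Multiplicative.ofAdd x) :=
          (alphaPrimeTPoints_apply_ofAdd p 𝔴 l x).symm
      _ = (gammaTPoints R s : Multiplicative TChar →* (cmNumbers ⊗[ℚ] R)ˣ) (Multiplicative.ofAdd x) :=
          congrArg (fun φ : tTorusPoints R => (φ : Multiplicative TChar →* (cmNumbers ⊗[ℚ] R)ˣ) (Multiplicative.ofAdd x)) h
      _ = (s : Multiplicative infinityTypesCM →* (cmNumbers ⊗[ℚ] R)ˣ) (Multiplicative.ofAdd (gammaT x)) := gammaTPoints_apply_ofAdd s x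
      _ = (s : Multiplicative infinityTypesCM →* (cmNumbers ⊗[ℚ] R)ˣ) (Multiplicative.ofAdd 0) :=
          congrArg (fun n : infinityTypesCM => (s : Multiplicative infinityTypesCM →* (cmNumbers ⊗[ℚ] R)ˣ) (Multiplicative.ofAdd n))
            (LinearMap.mem_ker.mp hx)
      _ = 1 := map_one (s : Multiplicative infinityTypesCM →* (cmNumbers ⊗[ℚ] R)ˣ)
  calc (l : Multiplicative (LChar p) →* (cmNumbers ⊗[ℚ] R)ˣ) (Multiplicative.ofAdd y)
      = (l : Multiplicative (LChar p) →* (cmNumbers ⊗[ℚ] R)ˣ) (Multiplicative.ofAdd y' * Multiplicative.ofAdd (alphaPrimeT p 𝔴 x)) :=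
        congrArg (fun z : LChar p => (l : Multiplicative (LChar p) →* (cmNumbers ⊗[ℚ] R)ˣ) (Multiplicative.ofAdd z)) hy
    _ = (l : Multiplicative (LChar p) →* (cmNumbers ⊗[ℚ] R)ˣ) (Multiplicative.ofAdd y') *
          (l : Multiplicative (LChar p) →* (cmNumbers ⊗[ℚ] R)ˣ) (Multiplicative.ofAdd (alphaPrimeT p 𝔴 x)) := map_mul _ _ _
    _ = (l : Multiplicative (LChar p) →* (cmNumbers ⊗[ℚ] R)ˣ) (Multiplicative.ofAdd y') := by rw [h1, mul_one]

/-- The function `w ↦ l(sec w)` on `X^*(P)`. [cite: Milne1999, §6 p. 66 L5–L6] -/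
def liftFun (l : lTorusPoints p R) (w : Multiplicative (Additive (WeilLimit p))) : (cmNumbers ⊗[ℚ] R)ˣ :=
  (l : Multiplicative (LChar p) →* (cmNumbers ⊗[ℚ] R)ˣ) (Multiplicative.ofAdd (betaSec p (Multiplicative.toAdd w)))

omit h𝔴P h𝔴 [DecidableEq CMTypeOrbits] in
/-- [cite: Milne1999, §6 p. 66 L5–L6] -/
theorem liftFun_apply (l : lTorusPoints p R) (w : Multiplicative (Additive (WeilLimit p))) :
    liftFun p l w = (l : Multiplicative (LChar p) →* (cmNumbers ⊗[ℚ] R)ˣ) (Multiplicative.ofAdd (betaSec p (Multiplicative.toAdd w))) := rfl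

/-- `w ↦ l(sec w)` is multiplicative for a compatible pair. [cite: Milne1999, §6 p. 66 L5–L6] -/
theorem liftFun_mul (l : lTorusPoints p R) (s : serreLimitPoints R) (h : alphaPrimeTPoints p 𝔴 R l = gammaTPoints R s)
    (w w' : Multiplicative (Additive (WeilLimit p))) : liftFun p l (w * w') = liftFun p l w * liftFun p l w' :=
  (apply_eq_of_betaL_eq p 𝔴 l s h (y := betaSec p (Multiplicative.toAdd w + Multiplicative.toAdd w'))
      (y' := betaSec p (Multiplicative.toAdd w) + betaSec p (Multiplicative.toAdd w'))
      ((betaL_betaSec p _).trans (((map_add (betaL p) _ _).trans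
        (congrArg₂ (· + ·) (betaL_betaSec p (Multiplicative.toAdd w)) (betaL_betaSec p (Multiplicative.toAdd w')))).symm))).trans
    (map_mul (l : Multiplicative (LChar p) →* (cmNumbers ⊗[ℚ] R)ˣ) (Multiplicative.ofAdd (betaSec p (Multiplicative.toAdd w)))
      (Multiplicative.ofAdd (betaSec p (Multiplicative.toAdd w'))))

/-- … sends `1` to `1`. [cite: Milne1999, §6 p. 66 L5–L6] -/
theorem liftFun_one (l : lTorusPoints p R) (s : serreLimitPoints R) (h : alphaPrimeTPoints p 𝔴 R l = gammaTPoints R s) : liftFun p l 1 = 1 :=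
  (apply_eq_of_betaL_eq p 𝔴 l s h (y := betaSec p 0) (y' := 0) ((betaL_betaSec p 0).trans (map_zero (betaL p)).symm)).trans
    (map_one (l : Multiplicative (LChar p) →* (cmNumbers ⊗[ℚ] R)ˣ))

/-- … and is `Γ`-equivariant (`X^*(β)` and `l` are). [cite: Milne1999, §6 p. 66 L5–L6] [cite: Milne2017, Ch. 12 Rem. 12.26] -/
theorem liftFun_smul (l : lTorusPoints p R) (s : serreLimitPoints R) (h : alphaPrimeTPoints p 𝔴 R l = gammaTPoints R s)
    (σ : cmNumbers ≃ₐ[ℚ] cmNumbers) (w : Additive (WeilLimit p)) :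
    liftFun p l (Multiplicative.ofAdd (weilLimRep p σ w)) = galUnits ℚ cmNumbers R σ (liftFun p l (Multiplicative.ofAdd w)) :=
  (apply_eq_of_betaL_eq p 𝔴 l s h (y := betaSec p (weilLimRep p σ w)) (y' := lRepL p σ (betaSec p w))
      ((betaL_betaSec p _).trans (((betaL_rep σ (betaSec p w)).trans (congrArg (weilLimRep p σ) (betaL_betaSec p w))).symm))).trans
    (Literature.RingTheory.GaloisAlgebras.CharacterModuleTorus.torusPoints.apply_smul l σ (betaSec p w))

variable (R)

/-- **THE POINT OF `P` DEFINED BY A COMPATIBLE PAIR**: for `(l, s)` with `α′(R)(l) = γ(R)(s)`, `w ↦ l(sec w)` is a `Γ`-equivariant homomorphism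
`X^*(P) → (ℚ^{cm} ⊗ R)ˣ`, i.e. a point of `P(R)`. [cite: Milne1999, §6 p. 66 L5–L6 (Theorem 6.1 «identifies P with L ∩ S (intersection in T)»)] [cite: Milne2017, Ch. 12 Rem. 12.26] -/
def liftPoint (l : lTorusPoints p R) (s : serreLimitPoints R) (h : alphaPrimeTPoints p 𝔴 R l = gammaTPoints R s) : weilTorusPoints p R :=
  ⟨{ toFun := liftFun p l
     map_one' := liftFun_one p 𝔴 l s h
     map_mul' := liftFun_mul p 𝔴 l s h },
    fun σ w => liftFun_smul p 𝔴 l s h σ w⟩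

variable {R}

/-- Values of the lifted point: `f(w) = l(sec w)`. [cite: Milne1999, §6 p. 66 L5–L6] -/
theorem liftPoint_apply_ofAdd (l : lTorusPoints p R) (s : serreLimitPoints R) (h : alphaPrimeTPoints p 𝔴 R l = gammaTPoints R s)
    (w : Additive (WeilLimit p)) :
    (liftPoint p 𝔴 R l s h : Multiplicative (Additive (WeilLimit p)) →* (cmNumbers ⊗[ℚ] R)ˣ) (Multiplicative.ofAdd w) =
      (l : Multiplicative (LChar p) →* (cmNumbers ⊗[ℚ] R)ˣ) (Multiplicative.ofAdd (betaSec p w)) := rfl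

/-- **`β(R)(f) = l`** for the lifted point `f`. [cite: Milne1999, §6 p. 66 L5–L6 (Theorem 6.1)] -/
theorem betaLPoints_liftPoint (l : lTorusPoints p R) (s : serreLimitPoints R) (h : alphaPrimeTPoints p 𝔴 R l = gammaTPoints R s) :
    betaLPoints p R (liftPoint p 𝔴 R l s h) = l :=
  Subtype.ext (MonoidHom.ext fun y =>
    ((betaLPoints_apply_ofAdd (p := p) (liftPoint p 𝔴 R l s h) (Multiplicative.toAdd y)).trans
      (liftPoint_apply_ofAdd p 𝔴 l s h _)).trans (apply_eq_of_betaL_eq p 𝔴 l s h (betaL_betaSec p _)))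

/-- **`α(R)(f) = s`** for the lifted point `f`: at `n ∈ X^*(S)`, `f(α n) = l(sec (α n))`, and by THE LIFT of g21-#2 (`exists_lift`: the character square is almost
cartesian) `sec (α n) = α′(x)` with `γ(x) = n` for some `x`, so the value is `(α′(R) l)(x) = (γ(R) s)(x) = s(n)`.
[cite: Milne1999, §6 p. 66 L5–L6 (Theorem 6.1), p. 66 L50 ff. («almost cartesian»)] -/
theorem alphaLimPoints_liftPoint (l : lTorusPoints p R) (s : serreLimitPoints R) (h : alphaPrimeTPoints p 𝔴 R l = gammaTPoints R s) :
    alphaLimPoints p 𝔴 R (liftPoint p 𝔴 R l s h) = s := by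
  refine Subtype.ext (MonoidHom.ext fun n => ?_)
  obtain ⟨x, hx, hx'⟩ := exists_lift p 𝔴 (betaSec p (alphaLim p 𝔴 (Multiplicative.toAdd n))) (Multiplicative.toAdd n) (betaL_betaSec p _)
  calc (alphaLimPoints p 𝔴 R (liftPoint p 𝔴 R l s h) : Multiplicative infinityTypesCM →* (cmNumbers ⊗[ℚ] R)ˣ) n
      = (l : Multiplicative (LChar p) →* (cmNumbers ⊗[ℚ] R)ˣ) (Multiplicative.ofAdd (betaSec p (alphaLim p 𝔴 (Multiplicative.toAdd n)))) :=
        (alphaLimPoints_apply_ofAdd (p := p) (𝔴 := 𝔴) (R := R) (liftPoint p 𝔴 R l s h) (Multiplicative.toAdd n)).trans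
          (liftPoint_apply_ofAdd p 𝔴 l s h _)
    _ = (l : Multiplicative (LChar p) →* (cmNumbers ⊗[ℚ] R)ˣ) (Multiplicative.ofAdd (alphaPrimeT p 𝔴 x)) :=
        congrArg (fun z : LChar p => (l : Multiplicative (LChar p) →* (cmNumbers ⊗[ℚ] R)ˣ) (Multiplicative.ofAdd z)) hx.symm
    _ = (alphaPrimeTPoints p 𝔴 R l : Multiplicative TChar →* (cmNumbers ⊗[ℚ] R)ˣ) (Multiplicative.ofAdd x) :=
        (alphaPrimeTPoints_apply_ofAdd p 𝔴 l x).symm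
    _ = (gammaTPoints R s : Multiplicative TChar →* (cmNumbers ⊗[ℚ] R)ˣ) (Multiplicative.ofAdd x) :=
        congrArg (fun φ : tTorusPoints R => (φ : Multiplicative TChar →* (cmNumbers ⊗[ℚ] R)ˣ) (Multiplicative.ofAdd x)) h
    _ = (s : Multiplicative infinityTypesCM →* (cmNumbers ⊗[ℚ] R)ˣ) (Multiplicative.ofAdd (gammaT x)) := gammaTPoints_apply_ofAdd s x
    _ = (s : Multiplicative infinityTypesCM →* (cmNumbers ⊗[ℚ] R)ˣ) n :=
        congrArg (fun z : infinityTypesCM => (s : Multiplicative infinityTypesCM →* (cmNumbers ⊗[ℚ] R)ˣ) (Multiplicative.ofAdd z)) hx'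

/-- **MILNE 1999 THEOREM 6.1 ON `R`-POINTS: `P(R) → L(R) ×_{T(R)} S(R)` IS A BIJECTION** for every commutative `ℚ`-algebra `R` — every compatible pair
`(l, s)`, `α′(R)(l) = γ(R)(s)`, is `(β(R)(f), α(R)(f))` for a UNIQUE `f ∈ P(R)`: «THEOREM 6.1. The diagram at left commutes, and identifies P with L ∩ S
(intersection in T)» read on the functor of points of the pro-tori with the character modules `X^*(T)`, `X^*(L)`, `X^*(S)`, `X^*(P)` of g21-#1 (the Tannakian
identification of these groups with fundamental groups of categories of motives is NOT claimed; nothing here is a case of the Hodge conjecture).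
[cite: Milne1999, §6 p. 66 L5–L6 (Theorem 6.1), L33–L49] [cite: Milne2017, Ch. 12 Th. 12.9 (b), Rem. 12.26] -/
theorem existsUnique_weilTorusPoints (l : lTorusPoints p R) (s : serreLimitPoints R) (h : alphaPrimeTPoints p 𝔴 R l = gammaTPoints R s) :
    ∃! f : weilTorusPoints p R, betaLPoints p R f = l ∧ alphaLimPoints p 𝔴 R f = s :=
  ⟨liftPoint p 𝔴 R l s h, ⟨betaLPoints_liftPoint p 𝔴 l s h, alphaLimPoints_liftPoint p 𝔴 l s h⟩,
    fun _ hf => betaLPoints_injective p R (hf.1.trans (betaLPoints_liftPoint p 𝔴 l s h).symm)⟩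

variable (R)

/-- **The fibre product `L(R) ×_{T(R)} S(R)`** as a subgroup of `L(R) × S(R)`: the pairs `(l, s)` with `α′(R)(l) = γ(R)(s)`. [cite: Milne1999, §6 p. 66 L5–L6] -/
def fibreProdPoints : Subgroup (lTorusPoints p R × serreLimitPoints R) :=
  MonoidHom.eqLocus ((alphaPrimeTPoints p 𝔴 R).comp (MonoidHom.fst _ _)) ((gammaTPoints R).comp (MonoidHom.snd _ _))

variable {R} in
/-- [cite: Milne1999, §6 p. 66 L5–L6] -/
theorem mem_fibreProdPoints_iff (ls : lTorusPoints p R × serreLimitPoints R) :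
    ls ∈ fibreProdPoints p 𝔴 R ↔ alphaPrimeTPoints p 𝔴 R ls.1 = gammaTPoints R ls.2 := Iff.rfl

/-- **`(β(R), α(R)) : P(R) → L(R) ×_{T(R)} S(R)`** (it lands in the fibre product by LEMMA 6.2 on points, g21-#1 `gammaTPoints_alphaLimPoints`).
[cite: Milne1999, §6 p. 66 L5–L12] -/
def toFibreProdPoints : weilTorusPoints p R →* fibreProdPoints p 𝔴 R :=
  ((betaLPoints p R).prod (alphaLimPoints p 𝔴 R)).codRestrict _ fun f => (gammaTPoints_alphaLimPoints p 𝔴 f).symm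

variable {R} in
/-- [cite: Milne1999, §6 p. 66 L5–L12] -/
@[simp] theorem coe_toFibreProdPoints (f : weilTorusPoints p R) :
    ((toFibreProdPoints p 𝔴 R f : fibreProdPoints p 𝔴 R) : lTorusPoints p R × serreLimitPoints R) = (betaLPoints p R f, alphaLimPoints p 𝔴 R f) := rfl

/-- **THEOREM 6.1 ON POINTS: `P(R) → L(R) ×_{T(R)} S(R)` is bijective.** [cite: Milne1999, §6 p. 66 L5–L6 (Theorem 6.1)] -/
theorem toFibreProdPoints_bijective : Function.Bijective (toFibreProdPoints p 𝔴 R) :=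
  ⟨fun _ _ hfg => betaLPoints_injective p R
      (congrArg (fun z : fibreProdPoints p 𝔴 R => (z : lTorusPoints p R × serreLimitPoints R).1) hfg),
    fun z => ⟨liftPoint p 𝔴 R z.1.1 z.1.2 z.2,
      Subtype.ext (Prod.ext (betaLPoints_liftPoint p 𝔴 z.1.1 z.1.2 z.2) (alphaLimPoints_liftPoint p 𝔴 z.1.1 z.1.2 z.2))⟩⟩

/-- **`P(R) ≅ L(R) ×_{T(R)} S(R)`** for every commutative `ℚ`-algebra `R` («identifies P with L ∩ S (intersection in T)», on points).
[cite: Milne1999, §6 p. 66 L5–L6 (Theorem 6.1)] -/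
def weilTorusPointsEquivFibreProd : weilTorusPoints p R ≃* fibreProdPoints p 𝔴 R :=
  MulEquiv.ofBijective (toFibreProdPoints p 𝔴 R) (toFibreProdPoints_bijective p 𝔴 R)

variable {R} in
/-- [cite: Milne1999, §6 p. 66 L5–L6] -/
theorem coe_weilTorusPointsEquivFibreProd (f : weilTorusPoints p R) :
    ((weilTorusPointsEquivFibreProd p 𝔴 R f : fibreProdPoints p 𝔴 R) : lTorusPoints p R × serreLimitPoints R) =
      (betaLPoints p R f, alphaLimPoints p 𝔴 R f) := rfl

variable {R} in
/-- **`P(R) = L(R) ∩ S(R)` inside `T(R)`, literally**: a point of `T(R)` lying in the image of `α′(R)` AND in the image of `γ(R)`, `t = α′(R)(l) = γ(R)(s)`,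
is `γ(R)(α(R)(f))` for a point `f ∈ P(R)` with `β(R)(f) = l`, `α(R)(f) = s`, unique with these properties («identifies P with L ∩ S (intersection in
T)», on points). [cite: Milne1999, §6 p. 66 L5–L6 (Theorem 6.1)] -/
theorem exists_of_eq_of_eq (l : lTorusPoints p R) (s : serreLimitPoints R) (t : tTorusPoints R) (hl : alphaPrimeTPoints p 𝔴 R l = t)
    (hs : gammaTPoints R s = t) :
    ∃ f : weilTorusPoints p R, betaLPoints p R f = l ∧ alphaLimPoints p 𝔴 R f = s ∧ gammaTPoints R (alphaLimPoints p 𝔴 R f) = t :=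
  ⟨liftPoint p 𝔴 R l s (hl.trans hs.symm), betaLPoints_liftPoint p 𝔴 l s _, alphaLimPoints_liftPoint p 𝔴 l s _,
    (congrArg (gammaTPoints R) (alphaLimPoints_liftPoint p 𝔴 l s (hl.trans hs.symm))).trans hs⟩

end Points

end CMNumbers

end Literature.NumberTheory.ComplexMultiplication

end
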